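import Literature.NumberTheory.EllipticCurves.X1FourteenMordellWeil
import HarnessLib

/-!
# The rational points of `X₀(49) = 49a1`: the curve `y² + xy = x³ - x² - 2x - 1` has rank `0`
# and exactly two rational points, `O` and `(2, -1)`

Topic `NumberTheory/EllipticCurves`; sibling of `X1FourteenMordellWeil.lean` (the same method —
descent via `2`-isogeny with the *same* isogenous constant `b' = -7`, then torsion — for
`X₁(14) = 14a4`) and of `KubertTwoTenProofs.lean` (`X₁(2,10) = 20a`). Cremona's curve
`49a1 = [1, -1, 0, -2, -1] : y² + xy = x³ - x² - 2x - 1` (`Δ = -343 = -7³`, `j = -3375`, CM by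
`ℤ[(1 + √-7)/2]`) is the modular curve `X₀(49)`; Cremona's Table 1 (`N = 49`) records `r = 0`,
`|T| = 2`, i.e. `49a1(ℚ) = {O, (2, -1)}` — the two rational cusps of `X₀(49)`.
Everything here is a theorem; no named fact and no definition is introduced.

The substitution `X = 4x - 8`, `Y = 8y + 4x` carries `49a1` to the model with its rational
`2`-torsion point `(2, -1) ↦ T = (0, 0)` at the origin,

  `V : Y² = X³ + 21X² + 112X = X(X² + 21X + 112)`   (`⟨0, 21, 0, 112, 0⟩ : WeierstrassCurve ℚ`),

`a = 21`, `b = 112 = 2⁴·7`, `Δ(V) = 16·b²·(a² - 4b) = -1404928 = -2¹²·7³`, with `2`-isogenous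
curve `V' : Y² = X³ - 42X² - 7X` (`a' = -2a`, `b' = a² - 4b = -7`). The main theorems are

* `Curve49A1.points_twoTorsionNF` : every rational solution of `Y² = X³ + 21X² + 112X` has
  `X = 0`, i.e. `V(ℚ) = {O, T}`;
* `Curve49A1.points` : every rational solution of `y² + xy = x³ - x² - 2x - 1` is `(2, -1)`.

## Proof (descent via `2`-isogeny, then torsion)

1. **Rank `0`** (`Curve49A1.finite_point`; `TwoIsogenyDescent.lean`, Silverman–Tate III.5–6,
   *AEC* X.4.9). On `V` every affine `X ≠ 0` is `> 0` (`4(X² + 21X + 112) = (2X + 21)² + 7`)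
   and `v_p(X)` is even for `p ∉ {2, 7}` (`even_padicValRat_of_twoTorsionNF`, `p ∤ b = 112`), so
   one of `X, 2X, 7X, 14X` is a rational square. `2X = r²` is impossible: `X = 2u²` gives
   `(Y/(2u))² = 2u⁴ + 21u² + 56`, and in lowest terms `N² = 2M⁴ + 21M²e² + 56e⁴` is `≡ 2, 6, 7
   (mod 8)` for `M` odd and `≡ 8, 12 (mod 16)` for `M` even, `e` odd
   (`Curve49A1.torsorTwo_rat_false`); `14X = r²` is carried to the previous case by translation
   by `T`, `X ↦ 112/X = 2·(28/r)²`. Hence `α(V(ℚ)) ⊆ {[1], [7] = [112]}`. On `V'`, `v_p(X)` is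
   even for `p ≠ 7`; `X = -w²` gives `(Y/w)² = -w⁴ - 42w² + 7`, whose lowest-terms form
   `N² = -M⁴ - 42M²e² + 7e⁴` is `≡ 12 (mod 16)` or `≡ 3 (mod 4)`
   (`Curve49A1.torsorNegOne_rat_false` — the same congruences as for `X₁(14)`, since
   `-42 ≡ 22 (mod 64)`), and `7X = w²` is carried to it by translation by `T'`,
   `X ↦ -7/X = -(7/w)²`. So `α'(V'(ℚ)) ⊆ {[1], [-7]}`, `V(ℚ) = 2V(ℚ) + {O, T}`, and `V(ℚ)` is
   finite by the tree's Mordell–Weil theorem (`finite_point_of_twoIsogenyDescent`).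
2. **Torsion**: `T = (0, 0)` is the only rational `2`-torsion point and `2Q ≠ T` for all `Q`
   (duplication formula `x(2Q)(2y)² = (x² - 112)²`, and `112` is not a rational square), so
   `2Q` has odd order for every `Q`; an odd-order point `P₀ = (x₀, y₀)` has `p`-integral `x₀` at
   every prime (*AEC* VII.3.1, VII.3.4: the tree's `val_le_one_of_zsmul_eq_zero` and
   `not_isOfFinAddOrder_of_one_lt_padicNorm_of_isIntegral`), `x₀ = w²` by the duplication
   formula, `w ∈ ℤ`, `v = y₀/w ∈ ℤ` with `v² = w⁴ + 21w² + 112`, which is impossible for every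
   integer `w`: `(w² + 10)² < w⁴ + 21w² + 112 < (w² + 11)²` (`Curve49A1.int_quartic_ne_sq`).
   So there is no odd-order point besides `O`.
3. Every point is `2Q = O` or `2Q + T = T`, whence `X = 0` for affine points
   (`Curve49A1.points_twoTorsionNF`), and `x = 2`, `y = -1` on `49a1` (`Curve49A1.points`).

## References

* [CremonaAlgorithms1997] J. E. Cremona, *Algorithms for Modular Elliptic Curves*, 2nd ed.
  (1997), Table 1, `N = 49`, curve `49a1 = [1, -1, 0, -2, -1]`: `r = 0`, `|T| = 2`.
* [SilvermanAEC2009] J. H. Silverman, *The Arithmetic of Elliptic Curves*, 2nd ed.: III.2.3(d)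
  (duplication), VII.3.1, VII.3.4 (torsion and reduction), VIII.6.7 (Mordell–Weil), X.4.9
  (descent via two-isogeny).
* J. H. Silverman, J. Tate, *Rational Points on Elliptic Curves* (1992), III.5–III.6 (not held).

## Design

Verbatim the design of `X1FourteenMordellWeil.lean` / `KubertTwoTenProofs.lean`: the curve is
the literal `⟨0, 21, 0, 112, 0⟩` (written out at each occurrence; no abbreviation is declared),
its `ℚ`-points carry Mathlib's group law with `ℚ`'s decidable equality, and the generic
descent/torsion files (classical instance) are bridged by the tree's `point_add_irrel` /
`point_zsmul_irrel`. `IsElliptic`, `IsIntegral ℤ` are supplied by `haveI`. The `2`-adic local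
insolubilities are reduced to finitely many statements over `ZMod 16` / `ZMod 8` / `ZMod 4`
checked by `decide`. All declarations live in the namespace `Curve49A1`.
-/

noncomputable section

open scoped Classical NNReal

namespace Literature.NumberTheory.EllipticCurves

namespace Curve49A1

open _root_.WeierstrassCurve KramerTwoDescent

/-! ### The curve `V : Y² = X³ + 21X² + 112X` -/

/-- `Δ(V) = -1404928 = -2¹² · 7³`. [folklore] -/
theorem Δ_eq : (⟨0, 21, 0, 112, 0⟩ : WeierstrassCurve ℚ).Δ = -1404928 := by
  norm_num [WeierstrassCurve.Δ, b₂, b₄, b₆, b₈]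

/-- `V` is an elliptic curve (`Δ ≠ 0`). [folklore] -/
theorem isElliptic : (⟨0, 21, 0, 112, 0⟩ : WeierstrassCurve ℚ).IsElliptic :=
  ⟨by rw [Δ_eq]; norm_num⟩

/-- The model has integer coefficients. [folklore] -/
theorem isIntegral : (⟨0, 21, 0, 112, 0⟩ : WeierstrassCurve ℚ).IsIntegral ℤ :=
  ⟨⟨⟨0, 21, 0, 112, 0⟩, by ext <;> simp [baseChange, map]⟩⟩

/-- The affine equation of `V`: `Y² = X³ + 21X² + 112X`. [folklore] -/
theorem equation_iff (x y : ℚ) :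
    (⟨0, 21, 0, 112, 0⟩ : WeierstrassCurve ℚ).toAffine.Equation x y ↔
      y ^ 2 = x ^ 3 + 21 * x ^ 2 + 112 * x := by
  rw [Affine.equation_iff]
  constructor <;> intro h <;> linear_combination h

/-- `T = (0, 0)` is a nonsingular point of `V` (`a₆ = 0`, `a₄ = 112 ≠ 0`). [folklore] -/
theorem nonsingular_T : (⟨0, 21, 0, 112, 0⟩ : WeierstrassCurve ℚ).toAffine.Nonsingular 0 0 := by
  rw [Affine.nonsingular_zero]
  norm_num

/-- A prime `p` with `(p : ℤ) ∣ 112 = 2⁴ · 7` is `2` or `7`. [folklore] -/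
theorem eq_two_or_seven_of_dvd {p : ℕ} (hp : p.Prime) (hd : (p : ℤ) ∣ 112) : p = 2 ∨ p = 7 := by
  have h : p ∣ 2 ^ 4 * 7 := by
    have h' : p ∣ 112 := by exact_mod_cast hd
    simpa using h'
  rcases (Nat.Prime.dvd_mul hp).mp h with h | h
  · exact Or.inl ((Nat.prime_dvd_prime_iff_eq hp Nat.prime_two).mp (hp.dvd_of_dvd_pow h))
  · exact Or.inr ((Nat.prime_dvd_prime_iff_eq hp (by decide)).mp h)

/-- `v_p(q · x) ≡ v_p(x) + [p = q] (mod 2)` for primes `p, q`: multiplying by the prime `q`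
flips the parity of the `q`-adic valuation and preserves all the others. [folklore] -/
theorem even_padicValRat_prime_mul {q : ℕ} (hq : q.Prime) {x : ℚ} (hx : x ≠ 0) (p : ℕ)
    [Fact p.Prime] :
    Even (padicValRat p ((q : ℚ) * x)) ↔ (p ≠ q ↔ Even (padicValRat p x)) := by
  rw [padicValRat.mul (by exact_mod_cast hq.ne_zero) hx]
  by_cases hpq : p = q
  · subst hpq
    rw [padicValRat.self hq.one_lt]
    simp only [ne_eq, not_true_eq_false, false_iff]
    rw [add_comm, Int.even_add_one]
  · have h0 : padicValRat p (q : ℚ) = 0 := by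
      rw [show ((q : ℕ) : ℚ) = ((q : ℤ) : ℚ) by norm_num]
      refine padicValRat_intCast_eq_zero fun hd => hpq ?_
      have hd' : p ∣ q := by exact_mod_cast hd
      exact (Nat.prime_dvd_prime_iff_eq (Fact.out) hq).mp hd'
    rw [h0, zero_add]
    simp [hpq]

/-! ### `2`-adic insolubility of the torsor `N² = 2M⁴ + 21M²e² + 56e⁴` (`[2] ∉ α(V(ℚ))`) -/

/-- For `m = 2k + 1` odd and any `e`: `2m⁴ + 21m²e² + 56e⁴ ≡ 2 + 5e² ∈ {2, 6, 7} (mod 8)` is not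
a square mod `8`. [folklore] -/
theorem torsorTwo_odd_eight :
    ∀ k e n : ZMod 8, n ^ 2 ≠ 2 * (2 * k + 1) ^ 4 + 21 * (2 * k + 1) ^ 2 * e ^ 2
      + 56 * e ^ 4 := by
  decide

/-- For `m = k + k` even, `e = 2l + 1` odd: `2m⁴ + 21m²e² + 56e⁴ ≡ 8` or `12 (mod 16)`.
[folklore] -/
theorem torsorTwo_even_odd_sixteen :
    ∀ k l : ZMod 16, 2 * (k + k) ^ 4 + 21 * (k + k) ^ 2 * (2 * l + 1) ^ 2
      + 56 * (2 * l + 1) ^ 4 = 8 ∨ 2 * (k + k) ^ 4 + 21 * (k + k) ^ 2 * (2 * l + 1) ^ 2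
      + 56 * (2 * l + 1) ^ 4 = 12 := by
  decide

/-- Squares mod `16` are never `8`. [folklore] -/
theorem sq_ne_eight_sixteen : ∀ n : ZMod 16, n ^ 2 ≠ 8 := by decide

/-- **The torsor `N² = 2M⁴ + 21M²e² + 56e⁴` has no integer point with `M`, `e` not both
even**: `2`-adically, `M` odd gives `N² ≡ 2, 6, 7 (mod 8)` and `M` even, `e` odd gives
`N² ≡ 8, 12 (mod 16)`. This is the local computation `[2] ∉ α(V(ℚ))` of the descent via
`2`-isogeny for `Y² = X³ + 21X² + 112X` (Silverman–Tate III.6: the equations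
`N² = b₁M⁴ + aM²e² + b₂e⁴`, `b₁b₂ = b = 112`, here `b₁ = 2`). [folklore] -/
theorem torsorTwo_int_false {M e N : ℤ} (hcop : ¬ (2 ∣ M ∧ 2 ∣ e))
    (h : N ^ 2 = 2 * M ^ 4 + 21 * M ^ 2 * e ^ 2 + 56 * e ^ 4) : False := by
  rcases Int.even_or_odd M with ⟨k, hk⟩ | ⟨k, hk⟩
  · rcases Int.even_or_odd e with ⟨l, hl⟩ | ⟨l, hl⟩
    · exact hcop ⟨⟨k, by rw [hk]; ring⟩, ⟨l, by rw [hl]; ring⟩⟩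
    · subst hk hl
      have h16 := congrArg (Int.cast : ℤ → ZMod 16) h
      push_cast at h16
      rcases torsorTwo_even_odd_sixteen (k : ZMod 16) (l : ZMod 16) with h8 | h12
      · rw [h8] at h16
        exact sq_ne_eight_sixteen _ h16
      · rw [h12] at h16
        exact ZMod.sq_ne_twelve_sixteen _ h16
  · subst hk
    have h8 := congrArg (Int.cast : ℤ → ZMod 8) h
    push_cast at h8
    exact torsorTwo_odd_eight _ _ _ h8

/-- **`z² = 2w⁴ + 21w² + 56` has no rational solution.** Write `w = M/e` in lowest terms; then
`N = z e²` is an integer (a rational whose square is an integer) with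
`N² = 2M⁴ + 21M²e² + 56e⁴`, contradicting `torsorTwo_int_false`. [folklore] -/
theorem torsorTwo_rat_false (w z : ℚ) (h : z ^ 2 = 2 * w ^ 4 + 21 * w ^ 2 + 56) : False := by
  set M : ℤ := w.num with hM
  set e : ℕ := w.den with he
  have hw : w * e = M := Rat.mul_den_eq_num w
  have hK : (z * (e : ℚ) ^ 2) ^ 2 =
      ((2 * M ^ 4 + 21 * M ^ 2 * (e : ℤ) ^ 2 + 56 * (e : ℤ) ^ 4 : ℤ) : ℚ) := by
    push_cast
    calc (z * (e : ℚ) ^ 2) ^ 2 = z ^ 2 * (e : ℚ) ^ 4 := by ring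
      _ = (2 * w ^ 4 + 21 * w ^ 2 + 56) * (e : ℚ) ^ 4 := by rw [h]
      _ = 2 * (w * e) ^ 4 + 21 * (w * e) ^ 2 * (e : ℚ) ^ 2 + 56 * (e : ℚ) ^ 4 := by ring
      _ = _ := by rw [hw]
  have hden : (z * (e : ℚ) ^ 2).den = 1 := Rat.den_eq_one_of_sq_eq_intCast hK
  have hNQ : (((z * (e : ℚ) ^ 2).num : ℤ) : ℚ) = z * (e : ℚ) ^ 2 :=
    Rat.coe_int_num_of_den_eq_one hden
  set N : ℤ := (z * (e : ℚ) ^ 2).num with hN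
  have hZ : N ^ 2 = 2 * M ^ 4 + 21 * M ^ 2 * (e : ℤ) ^ 2 + 56 * (e : ℤ) ^ 4 := by
    have : ((N : ℤ) : ℚ) ^ 2 =
        ((2 * M ^ 4 + 21 * M ^ 2 * (e : ℤ) ^ 2 + 56 * (e : ℤ) ^ 4 : ℤ) : ℚ) := by
      rw [hNQ, hK]
    exact_mod_cast this
  refine torsorTwo_int_false (M := M) (e := (e : ℤ)) (N := N) ?_ hZ
  rintro ⟨h2M, h2e⟩
  have hcop : M.natAbs.Coprime e := w.reduced
  have h1 : (2 : ℕ) ∣ M.natAbs := Int.ofNat_dvd_left.mp h2M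
  have h2 : (2 : ℕ) ∣ e := by exact_mod_cast h2e
  exact absurd (Nat.eq_one_of_dvd_coprimes hcop h1 h2) (by norm_num)

/-! ### `2`-adic insolubility of the torsor `N² = -M⁴ - 42M²e² + 7e⁴` (`[-1] ∉ α'(V'(ℚ))`) -/

/-- For odd `m = 2k + 1`, `e = 2l + 1`: `-m⁴ - 42m²e² + 7e⁴ ≡ 12 (mod 16)`. [folklore] -/
theorem torsorNegOne_odd_odd_sixteen :
    ∀ k l : ZMod 16, -(2 * k + 1) ^ 4 - 42 * (2 * k + 1) ^ 2 * (2 * l + 1) ^ 2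
      + 7 * (2 * l + 1) ^ 4 = 12 := by
  decide

/-- For `m = k + k` even, `e = 2l + 1` odd: `-m⁴ - 42m²e² + 7e⁴ ≡ 3 (mod 4)` is not a square.
[folklore] -/
theorem torsorNegOne_even_odd_four :
    ∀ k l n : ZMod 4, n ^ 2 ≠ -(k + k) ^ 4 - 42 * (k + k) ^ 2 * (2 * l + 1) ^ 2
      + 7 * (2 * l + 1) ^ 4 := by
  decide

/-- For `m = 2k + 1` odd, `e = l + l` even: `-m⁴ - 42m²e² + 7e⁴ ≡ 3 (mod 4)` is not a square.
[folklore] -/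
theorem torsorNegOne_odd_even_four :
    ∀ k l n : ZMod 4, n ^ 2 ≠ -(2 * k + 1) ^ 4 - 42 * (2 * k + 1) ^ 2 * (l + l) ^ 2
      + 7 * (l + l) ^ 4 := by
  decide

/-- **The torsor `N² = -M⁴ - 42M²e² + 7e⁴` has no integer point with `M`, `e` not both even**:
`2`-adically, `(M, e)` odd–odd gives `N² ≡ 12 (mod 16)`, and mixed parity gives
`N² ≡ 3 (mod 4)`. This is the local computation `[-1] ∉ α'(V'(ℚ))` of the descent via
`2`-isogeny for `Y² = X³ + 21X² + 112X` (Silverman–Tate III.6: the equations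
`N² = b₁M⁴ + a'M²e² + b₂e⁴`, `b₁b₂ = b' = -7`, here `b₁ = -1`, `a' = -42`). [folklore] -/
theorem torsorNegOne_int_false {M e N : ℤ} (hcop : ¬ (2 ∣ M ∧ 2 ∣ e))
    (h : N ^ 2 = -M ^ 4 - 42 * M ^ 2 * e ^ 2 + 7 * e ^ 4) : False := by
  rcases Int.even_or_odd M with ⟨k, hk⟩ | ⟨k, hk⟩ <;>
    rcases Int.even_or_odd e with ⟨l, hl⟩ | ⟨l, hl⟩
  · exact hcop ⟨⟨k, by rw [hk]; ring⟩, ⟨l, by rw [hl]; ring⟩⟩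
  · subst hk hl
    have h4 := congrArg (Int.cast : ℤ → ZMod 4) h
    push_cast at h4
    exact torsorNegOne_even_odd_four _ _ _ h4
  · subst hk hl
    have h4 := congrArg (Int.cast : ℤ → ZMod 4) h
    push_cast at h4
    exact torsorNegOne_odd_even_four _ _ _ h4
  · subst hk hl
    have h16 := congrArg (Int.cast : ℤ → ZMod 16) h
    push_cast at h16
    rw [torsorNegOne_odd_odd_sixteen] at h16
    exact ZMod.sq_ne_twelve_sixteen _ h16

/-- **`z² = -w⁴ - 42w² + 7` has no rational solution.** Write `w = M/e` in lowest terms; then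
`N = z e²` is an integer with `N² = -M⁴ - 42M²e² + 7e⁴`, contradicting
`torsorNegOne_int_false`. [folklore] -/
theorem torsorNegOne_rat_false (w z : ℚ) (h : z ^ 2 = -w ^ 4 - 42 * w ^ 2 + 7) : False := by
  set M : ℤ := w.num with hM
  set e : ℕ := w.den with he
  have hw : w * e = M := Rat.mul_den_eq_num w
  have hK : (z * (e : ℚ) ^ 2) ^ 2 =
      ((-M ^ 4 - 42 * M ^ 2 * (e : ℤ) ^ 2 + 7 * (e : ℤ) ^ 4 : ℤ) : ℚ) := by
    push_cast
    calc (z * (e : ℚ) ^ 2) ^ 2 = z ^ 2 * (e : ℚ) ^ 4 := by ring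
      _ = (-w ^ 4 - 42 * w ^ 2 + 7) * (e : ℚ) ^ 4 := by rw [h]
      _ = -(w * e) ^ 4 - 42 * (w * e) ^ 2 * (e : ℚ) ^ 2 + 7 * (e : ℚ) ^ 4 := by ring
      _ = _ := by rw [hw]
  have hden : (z * (e : ℚ) ^ 2).den = 1 := Rat.den_eq_one_of_sq_eq_intCast hK
  have hNQ : (((z * (e : ℚ) ^ 2).num : ℤ) : ℚ) = z * (e : ℚ) ^ 2 :=
    Rat.coe_int_num_of_den_eq_one hden
  set N : ℤ := (z * (e : ℚ) ^ 2).num with hN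
  have hZ : N ^ 2 = -M ^ 4 - 42 * M ^ 2 * (e : ℤ) ^ 2 + 7 * (e : ℤ) ^ 4 := by
    have : ((N : ℤ) : ℚ) ^ 2 =
        ((-M ^ 4 - 42 * M ^ 2 * (e : ℤ) ^ 2 + 7 * (e : ℤ) ^ 4 : ℤ) : ℚ) := by
      rw [hNQ, hK]
    exact_mod_cast this
  refine torsorNegOne_int_false (M := M) (e := (e : ℤ)) (N := N) ?_ hZ
  rintro ⟨h2M, h2e⟩
  have hcop : M.natAbs.Coprime e := w.reduced
  have h1 : (2 : ℕ) ∣ M.natAbs := Int.ofNat_dvd_left.mp h2M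
  have h2 : (2 : ℕ) ∣ e := by exact_mod_cast h2e
  exact absurd (Nat.eq_one_of_dvd_coprimes hcop h1 h2) (by norm_num)

/-- **`v² = w⁴ + 21w² + 112` has no integer solution**: for every integer `w`,
`(w² + 10)² < w⁴ + 21w² + 112 < (w² + 11)²`. [folklore] -/
theorem int_quartic_ne_sq {k j : ℤ} (h : j ^ 2 = (k ^ 2) ^ 2 + 21 * k ^ 2 + 112) : False := by
  set u := k ^ 2 + 10 with hu
  have hk : 0 ≤ k ^ 2 := sq_nonneg k
  have hlow : u ^ 2 < j ^ 2 := by nlinarith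
  have hup : j ^ 2 < (u + 1) ^ 2 := by nlinarith
  have h3 : |u| < |j| := sq_lt_sq.mp hlow
  have h4 : |j| < |u + 1| := sq_lt_sq.mp hup
  rw [abs_of_nonneg (by omega : (0 : ℤ) ≤ u)] at h3
  rw [abs_of_nonneg (by omega : (0 : ℤ) ≤ u + 1)] at h4
  rcases abs_choice j with hj | hj <;> rw [hj] at h3 h4 <;> omega

/-! ### The descent hypotheses for `V` and its `2`-isogenous curve -/

/-- **`[2] ∉ α(V(ℚ))`**: no rational point `(X, Y)` of `V : Y² = X³ + 21X² + 112X` has `2X` a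
nonzero square (`2X = r²`, i.e. `X = 2u²` with `u = r/2`, gives `(Y/r)² = 2u⁴ + 21u² + 56`,
`torsorTwo_rat_false`). [folklore] -/
theorem two_mul_ne_sq {x y r : ℚ} (he : y ^ 2 = x ^ 3 + 21 * x ^ 2 + 112 * x)
    (hr : r ≠ 0) (hx : 2 * x = r ^ 2) : False := by
  refine torsorTwo_rat_false (r / 2) (y / r) ?_
  have hx' : x = r ^ 2 / 2 := by linear_combination hx / 2
  subst hx'
  rw [div_pow y, div_eq_iff (pow_ne_zero 2 hr)]
  linear_combination he

/-- **`α(V(ℚ)) ⊆ {[1], [112]}`**: on `Y² = X³ + 21X² + 112X` (`b = 112 = 2⁴·7`), every rational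
point with `X ≠ 0` has `X > 0` (`X(X² + 21X + 112) = Y²`, `4(X² + 21X + 112) = (2X + 21)² + 7`)
and `v_p(X)` even for `p ∉ {2, 7}` (`p ∤ b`), so one of `X`, `7X`, `2X`, `14X` is a rational
square according to the parities of `v₂(X)`, `v₇(X)`; in the second case `112X = (4w)²`, the
third is excluded by `two_mul_ne_sq`, and so is the fourth after translation by `T`:
`T + (X, Y) = (112/X, -112Y/X²)` has `2 · (112/X) = (56/r)²` when `14X = r²`. [folklore] -/
theorem sq_or_mul_sq {x y : ℚ} (h : (⟨0, 21, 0, 112, 0⟩ : WeierstrassCurve ℚ).toAffine.Nonsingular x y)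
    (hx : x ≠ 0) :
    ∃ w : ℚ, x = w ^ 2 ∨ (⟨0, 21, 0, 112, 0⟩ : WeierstrassCurve ℚ).a₄ * x = w ^ 2 := by
  haveI := fact_prime_seven
  have he : y ^ 2 = x ^ 3 + ((21 : ℤ) : ℚ) * x ^ 2 + ((112 : ℤ) : ℚ) * x := by
    have := (equation_iff x y).mp h.1
    push_cast; linear_combination this
  have he' : y ^ 2 = x ^ 3 + 21 * x ^ 2 + 112 * x := by push_cast at he; linear_combination he
  -- positivity
  have hpos : 0 < x := by
    have hq : 0 < (2 * x + 21) ^ 2 + 7 := by positivity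
    have hprod : x * ((2 * x + 21) ^ 2 + 7) = 4 * y ^ 2 := by linear_combination -4 * he'
    by_contra hle
    have hlt : x < 0 := lt_of_le_of_ne (not_lt.mp hle) hx
    nlinarith [sq_nonneg y, mul_neg_of_neg_of_pos hlt hq]
  -- parities away from `2` and `7`
  have heven : ∀ p : ℕ, p.Prime → p ≠ 2 → p ≠ 7 → Even (padicValRat p x) :=
    fun p hp hp2 hp7 => by
      haveI : Fact p.Prime := ⟨hp⟩
      exact even_padicValRat_of_twoTorsionNF he hx fun hd =>
        (eq_two_or_seven_of_dvd hp hd).elim hp2 hp7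
  have hcoef : (⟨0, 21, 0, 112, 0⟩ : WeierstrassCurve ℚ).a₄ = 112 := rfl
  rw [hcoef]
  have h2Q : (2 : ℚ) = ((2 : ℕ) : ℚ) := by norm_num
  have h7Q : (7 : ℚ) = ((7 : ℕ) : ℚ) := by norm_num
  have h7x0 : (7 : ℚ) * x ≠ 0 := mul_ne_zero (by norm_num) hx
  by_cases h2 : Even (padicValRat 2 x) <;> by_cases h7 : Even (padicValRat 7 x)
  · -- `x` is a square
    obtain ⟨r, hr⟩ := exists_sq_of_even_padicValRat hpos fun p hp => by
      by_cases hp2 : p = 2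
      · subst hp2; exact h2
      by_cases hp7 : p = 7
      · subst hp7; exact h7
      exact heven p hp hp2 hp7
    exact ⟨r, Or.inl hr⟩
  · -- `7x` is a square
    obtain ⟨r, hr⟩ := exists_sq_of_even_padicValRat (mul_pos (by norm_num) hpos : (0 : ℚ) < 7 * x)
      fun p hp => by
        haveI : Fact p.Prime := ⟨hp⟩
        rw [h7Q, even_padicValRat_prime_mul (by decide) hx]
        by_cases hp7 : p = 7
        · subst hp7; simpa using h7
        simp only [ne_eq, hp7, not_false_eq_true, true_iff]
        by_cases hp2 : p = 2
        · subst hp2; exact h2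
        exact heven p hp hp2 hp7
    exact ⟨4 * r, Or.inr (by linear_combination 16 * hr)⟩
  · -- `2x` is a square: excluded
    exfalso
    obtain ⟨r, hr⟩ := exists_sq_of_even_padicValRat (mul_pos (by norm_num) hpos : (0 : ℚ) < 2 * x)
      fun p hp => by
        haveI : Fact p.Prime := ⟨hp⟩
        rw [h2Q, even_padicValRat_prime_mul Nat.prime_two hx]
        by_cases hp2 : p = 2
        · subst hp2; simpa using h2
        simp only [ne_eq, hp2, not_false_eq_true, true_iff]
        by_cases hp7 : p = 7
        · subst hp7; exact h7
        exact heven p hp hp2 hp7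
    have hr0 : r ≠ 0 := by
      rintro rfl
      exact mul_ne_zero (by norm_num : (2 : ℚ) ≠ 0) hx (by rw [hr]; ring)
    exact two_mul_ne_sq he' hr0 hr
  · -- `14x` is a square: translate by `T` and reach the excluded case
    exfalso
    obtain ⟨r, hr⟩ := exists_sq_of_even_padicValRat
      (mul_pos (by norm_num) (mul_pos (by norm_num) hpos) : (0 : ℚ) < 2 * (7 * x)) fun p hp => by
        haveI : Fact p.Prime := ⟨hp⟩
        rw [h2Q, even_padicValRat_prime_mul Nat.prime_two h7x0, h7Q,
          even_padicValRat_prime_mul (by decide) hx]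
        by_cases hp2 : p = 2
        · subst hp2; simpa using h2
        by_cases hp7 : p = 7
        · subst hp7; simpa using h7
        simp only [ne_eq, hp2, not_false_eq_true, hp7, true_iff]
        exact heven p hp hp2 hp7
    have hr0 : r ≠ 0 := by
      rintro rfl
      exact mul_ne_zero (by norm_num : (2 : ℚ) ≠ 0) h7x0 (by rw [hr]; ring)
    -- the translate `(X', Y') = (112/x, -112y/x²)` lies on `V` and `2X' = (56/r)²`
    have heX : (-112 * y / x ^ 2) ^ 2 =
        (112 / x) ^ 3 + 21 * (112 / x) ^ 2 + 112 * (112 / x) := by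
      field_simp
      linear_combination he'
    refine two_mul_ne_sq heX (div_ne_zero (by norm_num) hr0 : (56 : ℚ) / r ≠ 0) ?_
    rw [div_pow, ← hr]
    field_simp
    norm_num

/-- **`[-1] ∉ α'(V'(ℚ))`**: no rational point `(X, Y)` of the isogenous curve
`V' : Y² = X³ - 42X² - 7X` has `-X` a nonzero square (`X = -w²` gives
`(Y/w)² = -w⁴ - 42w² + 7`, `torsorNegOne_rat_false`). [folklore] -/
theorem codomain_neg_ne_sq {X Y w : ℚ} (he : Y ^ 2 = X ^ 3 - 42 * X ^ 2 - 7 * X)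
    (hw : w ≠ 0) (hX : X = -w ^ 2) : False := by
  refine torsorNegOne_rat_false w (Y / w) ?_
  rw [div_pow, div_eq_iff (pow_ne_zero 2 hw)]
  rw [hX] at he
  linear_combination he

/-- **`α'(V'(ℚ)) ⊆ {[1], [-7]}`** for the `2`-isogenous curve `V' : Y² = X³ - 42X² - 7X` of `V`
(`a' = -42`, `b' = a² - 4b = -7`): every rational point with `X ≠ 0` has `X` or `-7X` a
rational square. Indeed `v_p(X)` is even for `p ≠ 7`; if `X > 0` with `v₇(X)` even then `X` is
a square, if `X < 0` with `v₇(X)` odd then `-7X` is a square; `X < 0` with `v₇(X)` even would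
make `-X` a square (`codomain_neg_ne_sq`), and `X > 0` with `v₇(X)` odd would make `7X = w²` a
square, so that the translate `T' + (X, Y) = (-7/X, 7Y/X²)` has abscissa `-(7/w)²`, again
excluded. (Literally the argument of `X1Fourteen_codomain_sq_or_neg_seven_mul_sq`, which has
the same `b' = -7`.) [folklore] -/
theorem codomain_sq_or_neg_seven_mul_sq {X Y : ℚ}
    (h : (⟨0, 21, 0, 112, 0⟩ : WeierstrassCurve ℚ).twoIsogenyCodomain.toAffine.Nonsingular X Y)
    (hX : X ≠ 0) :
    ∃ w : ℚ, X = w ^ 2 ∨ ((⟨0, 21, 0, 112, 0⟩ : WeierstrassCurve ℚ).a₂ ^ 2 -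
      4 * (⟨0, 21, 0, 112, 0⟩ : WeierstrassCurve ℚ).a₄) * X = w ^ 2 := by
  haveI := fact_prime_seven
  have he : Y ^ 2 = X ^ 3 + ((-42 : ℤ) : ℚ) * X ^ 2 + ((-7 : ℤ) : ℚ) * X := by
    have := WeierstrassCurve.rel_of_nonsingular
      (⟨0, 21, 0, 112, 0⟩ : WeierstrassCurve ℚ).twoIsogenyCodomain h
    simp only [twoIsogenyCodomain_a₂, twoIsogenyCodomain_a₄] at this
    push_cast; linear_combination this
  have he' : Y ^ 2 = X ^ 3 - 42 * X ^ 2 - 7 * X := by push_cast at he; linear_combination he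
  -- parities away from `7`
  have heven : ∀ p : ℕ, p.Prime → p ≠ 7 → Even (padicValRat p X) := fun p hp hp7 => by
    haveI : Fact p.Prime := ⟨hp⟩
    exact even_padicValRat_of_twoTorsionNF he hX fun hd => hp7 (eq_seven_of_dvd hp hd)
  have hcoef : (⟨0, 21, 0, 112, 0⟩ : WeierstrassCurve ℚ).a₂ ^ 2 -
      4 * (⟨0, 21, 0, 112, 0⟩ : WeierstrassCurve ℚ).a₄ = -7 := by norm_num
  rw [hcoef]
  have h7Q : padicValRat 7 (7 : ℚ) = 1 := by
    rw [show (7 : ℚ) = ((7 : ℕ) : ℚ) by norm_num, padicValRat.self (by norm_num)]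
  have h70 : ∀ p : ℕ, p.Prime → p ≠ 7 → padicValRat p (7 : ℚ) = 0 := fun p hp hp7 => by
    haveI : Fact p.Prime := ⟨hp⟩
    rw [show (7 : ℚ) = ((7 : ℤ) : ℚ) by norm_num]
    refine padicValRat_intCast_eq_zero fun hd => hp7 ?_
    have h77 : p ∣ 7 := by exact_mod_cast hd
    exact (Nat.prime_dvd_prime_iff_eq hp (by decide)).mp h77
  -- all valuations of `X` are even, or all valuations of `7X` (equivalently `-7X`) are even
  have hval : (∀ p : ℕ, p.Prime → Even (padicValRat p X)) ∨
      (∀ p : ℕ, p.Prime → Even (padicValRat p (7 * X))) := by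
    by_cases h7 : Even (padicValRat 7 X)
    · refine Or.inl fun p hp => ?_
      by_cases hp7 : p = 7
      · subst hp7; exact h7
      · exact heven p hp hp7
    · refine Or.inr fun p hp => ?_
      haveI : Fact p.Prime := ⟨hp⟩
      rw [padicValRat.mul (by norm_num) hX]
      by_cases hp7 : p = 7
      · subst hp7
        rw [h7Q]
        rcases Int.even_or_odd (padicValRat 7 X) with h' | h'
        · exact absurd h' h7
        · obtain ⟨k, hk⟩ := h'
          exact ⟨k + 1, by omega⟩
      · rw [h70 p hp hp7, zero_add]
        exact heven p hp hp7
  rcases lt_or_gt_of_ne hX with hneg | hpos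
  · -- `X < 0`
    rcases hval with hv | hv
    · -- `-X` is a square: impossible
      exfalso
      obtain ⟨w, hw⟩ := exists_sq_of_even_padicValRat (neg_pos.mpr hneg) fun p hp => by
        haveI : Fact p.Prime := ⟨hp⟩
        rw [padicValRat.neg]; exact hv p hp
      have hw0 : w ≠ 0 := by rintro rfl; apply hX; linear_combination -hw
      exact codomain_neg_ne_sq he' hw0 (by linear_combination -hw)
    · -- `-7X` is a square
      obtain ⟨w, hw⟩ := exists_sq_of_even_padicValRat
        (show (0 : ℚ) < -7 * X by nlinarith) fun p hp => by
          haveI : Fact p.Prime := ⟨hp⟩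
          rw [show (-7 : ℚ) * X = -(7 * X) by ring, padicValRat.neg]; exact hv p hp
      exact ⟨w, Or.inr hw⟩
  · -- `X > 0`
    rcases hval with hv | hv
    · obtain ⟨w, hw⟩ := exists_sq_of_even_padicValRat hpos hv
      exact ⟨w, Or.inl hw⟩
    · -- `7X = w²`: translate by `T'` and reach the excluded case
      exfalso
      obtain ⟨w, hw⟩ := exists_sq_of_even_padicValRat (mul_pos (by norm_num) hpos) hv
      have hw0 : w ≠ 0 := by
        rintro rfl
        exact mul_ne_zero (by norm_num : (7 : ℚ) ≠ 0) hX (by rw [hw]; ring)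
      -- the translate `(X', Y') = (-7/X, 7Y/X²)` lies on `V'` and `X' = -(7/w)²`
      have heX : (7 * Y / X ^ 2) ^ 2 = (-7 / X) ^ 3 - 42 * (-7 / X) ^ 2 - 7 * (-7 / X) := by
        field_simp
        linear_combination he'
      refine codomain_neg_ne_sq heX (div_ne_zero (by norm_num) hw0 : (7 : ℚ) / w ≠ 0) ?_
      rw [div_pow, ← hw]
      field_simp

/-! ### `V(ℚ)` is finite (rank `0`) -/

/-- **`V(ℚ)` is finite**: descent via `2`-isogeny (`finite_point_of_twoIsogenyDescent`, with
`α ⊆ {[1],[112]}`, `α' ⊆ {[1],[-7]}`) and the Mordell–Weil theorem. In Cremona's tables this is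
"`49a1`: `r = 0`". [cite: SilvermanAEC2009, X.4.9] -/
theorem finite_point : Finite (⟨0, 21, 0, 112, 0⟩ : WeierstrassCurve ℚ).toAffine.Point := by
  haveI := isElliptic
  exact finite_point_of_twoIsogenyDescent (⟨0, 21, 0, 112, 0⟩ : WeierstrassCurve ℚ)
    (fun h hx => sq_or_mul_sq h hx) (fun h hX => codomain_sq_or_neg_seven_mul_sq h hX)

/-! ### The group law on `V(ℚ)` in coordinates -/

/-- `-(x, y) = (x, -y)` on `V` (`a₁ = a₃ = 0`). [folklore] -/
theorem negY_eq (x y : ℚ) : (⟨0, 21, 0, 112, 0⟩ : WeierstrassCurve ℚ).toAffine.negY x y = -y := by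
  rw [Affine.negY, toAffine_a₁, toAffine_a₃]; ring

/-- The curve equation from nonsingularity. [folklore] -/
theorem rel {x y : ℚ} (h : (⟨0, 21, 0, 112, 0⟩ : WeierstrassCurve ℚ).toAffine.Nonsingular x y) :
    y ^ 2 = x ^ 3 + 21 * x ^ 2 + 112 * x :=
  (equation_iff x y).mp h.1

/-- `T + T = O` for `T = (0, 0)`. [folklore] -/
theorem T_add_T :
    (Affine.Point.some 0 0 nonsingular_T : (⟨0, 21, 0, 112, 0⟩ : WeierstrassCurve ℚ).toAffine.Point) +
      (Affine.Point.some 0 0 nonsingular_T : (⟨0, 21, 0, 112, 0⟩ : WeierstrassCurve ℚ).toAffine.Point) = 0 := by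
  exact Affine.Point.add_self_of_Y_eq (by rw [negY_eq, neg_zero])

/-- **The only rational `2`-torsion point of `V` is `T = (0, 0)`** (the other roots of
`X³ + 21X² + 112X` are `(-21 ± √-7)/2`: `4(X² + 21X + 112) = (2X + 21)² + 7 > 0`). [folklore] -/
theorem eq_T_of_add_self {P : (⟨0, 21, 0, 112, 0⟩ : WeierstrassCurve ℚ).toAffine.Point}
    (h2 : P + P = 0) (h0 : P ≠ 0) :
    P = (Affine.Point.some 0 0 nonsingular_T : (⟨0, 21, 0, 112, 0⟩ : WeierstrassCurve ℚ).toAffine.Point) := by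
  rcases P with _ | ⟨x, y, h⟩
  · exact absurd rfl h0
  have hy : y = (⟨0, 21, 0, 112, 0⟩ : WeierstrassCurve ℚ).toAffine.negY x y := by
    by_contra hy
    rw [Affine.Point.add_self_of_Y_ne hy] at h2
    exact Affine.Point.some_ne_zero _ h2
  rw [negY_eq] at hy
  have hy0 : y = 0 := by linarith
  have e := rel h
  rw [hy0] at e
  have hx : x * ((2 * x + 21) ^ 2 + 7) = 0 := by linear_combination -4 * e
  rcases mul_eq_zero.mp hx with hx0 | hx0
  · subst hx0 hy0; rfl
  · nlinarith [sq_nonneg (2 * x + 21)]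

/-- **Duplication on `V`**: `x(2P) · (2y)² = (x² - 112)²` for `P = (x, y)` with `y ≠ 0`
(Silverman, *AEC*, III.2.3(d) with `a = 21`, `b = 112`). [folklore] -/
theorem addX_self_mul {x y : ℚ} (h : (⟨0, 21, 0, 112, 0⟩ : WeierstrassCurve ℚ).toAffine.Nonsingular x y)
    (hy : y ≠ (⟨0, 21, 0, 112, 0⟩ : WeierstrassCurve ℚ).toAffine.negY x y) :
    (⟨0, 21, 0, 112, 0⟩ : WeierstrassCurve ℚ).toAffine.addX x x
        ((⟨0, 21, 0, 112, 0⟩ : WeierstrassCurve ℚ).toAffine.slope x x y y) * (2 * y) ^ 2 =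
      (x ^ 2 - 112) ^ 2 := by
  have e := rel h
  have hy2 : y - (⟨0, 21, 0, 112, 0⟩ : WeierstrassCurve ℚ).toAffine.negY x y = 2 * y := by
    rw [negY_eq]; ring
  have hℓ : (⟨0, 21, 0, 112, 0⟩ : WeierstrassCurve ℚ).toAffine.slope x x y y * (2 * y) =
      3 * x ^ 2 + 42 * x + 112 := by
    rw [Affine.slope_of_Y_ne rfl hy, hy2, toAffine_a₁, toAffine_a₂, toAffine_a₄,
      div_mul_cancel₀ _ (by rw [← hy2]; exact sub_ne_zero.mpr hy)]
    ring
  set ℓ := (⟨0, 21, 0, 112, 0⟩ : WeierstrassCurve ℚ).toAffine.slope x x y y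
  rw [Affine.addX, toAffine_a₁, toAffine_a₂]
  linear_combination (2 * y * ℓ + (3 * x ^ 2 + 42 * x + 112)) * hℓ + 4 * (-21 - 2 * x) * e

/-- `x² = 112` has no rational solution (`v₇(x²)` is even, `v₇(112) = 1`). [folklore] -/
theorem sq_ne_112 (x : ℚ) : x ^ 2 ≠ 112 := by
  haveI := fact_prime_seven
  intro h
  have hx : x ≠ 0 := by rintro rfl; norm_num at h
  have hv := congrArg (padicValRat 7) h
  rw [padicValRat.pow, show (112 : ℚ) = ((7 : ℕ) : ℚ) * ((16 : ℤ) : ℚ) by norm_num,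
    padicValRat.mul (by norm_num) (by norm_num), padicValRat.self (by norm_num),
    padicValRat_intCast_eq_zero (p := 7) (z := 16) (by decide)] at hv
  omega

/-- **No rational point `Q` with `2Q = T`** on `V` (`b = 112` is not a square: by the
duplication formula `x(2Q) = 0` would force `x² = 112`). This is "`T ∉ 2Γ`", i.e. no rational
`4`-torsion through `T`. [folklore] -/
theorem add_self_ne_T (Q : (⟨0, 21, 0, 112, 0⟩ : WeierstrassCurve ℚ).toAffine.Point) :
    Q + Q ≠ (Affine.Point.some 0 0 nonsingular_T : (⟨0, 21, 0, 112, 0⟩ : WeierstrassCurve ℚ).toAffine.Point) := by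
  intro hQ
  rcases Q with _ | ⟨x, y, h⟩
  · rw [← Affine.Point.zero_def, add_zero] at hQ
    exact (Affine.Point.some_ne_zero _) hQ.symm
  by_cases hy : y = (⟨0, 21, 0, 112, 0⟩ : WeierstrassCurve ℚ).toAffine.negY x y
  · rw [Affine.Point.add_self_of_Y_eq hy] at hQ
    exact (Affine.Point.some_ne_zero _) hQ.symm
  · have key := addX_self_mul h hy
    rw [Affine.Point.add_self_of_Y_ne hy, Affine.Point.some.injEq] at hQ
    rw [hQ.1, zero_mul] at key
    have : x ^ 2 - 112 = 0 := pow_eq_zero_iff two_ne_zero |>.mp key.symm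
    exact sq_ne_112 x (by linear_combination this)

/-! ### The rational points of `V` -/

/-- **`V(ℚ) = 2·V(ℚ) + {O, T}`** with Mathlib's (decidable-equality–`ℚ`) group law: the descent
lemma `exists_eq_two_smul_or` specialised to `V` (the generic files use the classical instance;
the two group laws agree). [cite: SilvermanAEC2009, X.4.9] -/
theorem exists_eq_add_self_or (P : (⟨0, 21, 0, 112, 0⟩ : WeierstrassCurve ℚ).toAffine.Point) :
    ∃ Q : (⟨0, 21, 0, 112, 0⟩ : WeierstrassCurve ℚ).toAffine.Point, P = Q + Q ∨
      P = Q + Q + (Affine.Point.some 0 0 nonsingular_T : (⟨0, 21, 0, 112, 0⟩ : WeierstrassCurve ℚ).toAffine.Point) := by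
  haveI := isElliptic
  obtain ⟨Q, hQ⟩ := (⟨0, 21, 0, 112, 0⟩ : WeierstrassCurve ℚ).exists_eq_two_smul_or
    (fun h hx => sq_or_mul_sq h hx) (fun h hX => codomain_sq_or_neg_seven_mul_sq h hX) P
  refine ⟨Q, ?_⟩
  have h2 : ∀ (d : DecidableEq ℚ) (R : (⟨0, 21, 0, 112, 0⟩ : WeierstrassCurve ℚ).toAffine.Point),
      (letI : DecidableEq ℚ := d; (2 • R :)) = @HAdd.hAdd _ _ _ (@instHAdd _
        (@WeierstrassCurve.Affine.Point.instAdd ℚ _ (⟨0, 21, 0, 112, 0⟩ : WeierstrassCurve ℚ).toAffine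
          instDecidableEqRat)) R R := by
    intro d R
    have hd : d = instDecidableEqRat := Subsingleton.elim _ _
    subst hd
    exact two_nsmul R
  rw [h2 _ Q] at hQ
  rcases hQ with hQ | hQ
  · exact Or.inl hQ
  · rw [point_add_irrel (fun a b => Classical.propDecidable (a = b)) instDecidableEqRat] at hQ
    exact Or.inr hQ

/-- **Odd-order rational points of `V` have integral abscissa** (Nagell–Lutz style): for a
rational point `P₀ = (x₀, y₀)` of odd order `m`, `‖x₀‖_p ≤ 1` at every prime `p` — at `p = 2`
because `m`-torsion with `‖m‖₂ = 1` is `2`-integral (`val_le_one_of_zsmul_eq_zero`, Silverman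
*AEC* VII.3.1), at odd `p` because `E₁(ℚ_p) ∩ E(ℚ)` is torsion-free
(`not_isOfFinAddOrder_of_one_lt_padicNorm_of_isIntegral`, *AEC* VII.3.4).
[cite: SilvermanAEC2009, VII.3.4] -/
theorem norm_le_one_of_odd {x₀ y₀ : ℚ}
    {h₀ : (⟨0, 21, 0, 112, 0⟩ : WeierstrassCurve ℚ).toAffine.Nonsingular x₀ y₀}
    (hfin : IsOfFinAddOrder (.some x₀ y₀ h₀ : (⟨0, 21, 0, 112, 0⟩ : WeierstrassCurve ℚ).toAffine.Point))
    (hodd : Odd (addOrderOf (.some x₀ y₀ h₀ : (⟨0, 21, 0, 112, 0⟩ : WeierstrassCurve ℚ).toAffine.Point)))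
    (p : ℕ) [Fact p.Prime] : ‖(x₀ : ℚ_[p])‖ ≤ 1 := by
  haveI := isElliptic
  haveI := isIntegral
  by_cases hp2 : p = 2
  · subst hp2
    haveI : (⟨0, 21, 0, 112, 0⟩ : WeierstrassCurve ℚ).IsIntegral (ratAdicValuation 2).integer :=
      (⟨0, 21, 0, 112, 0⟩ : WeierstrassCurve ℚ).isIntegral_integer_ratAdicValuation 2
    set m := addOrderOf (.some x₀ y₀ h₀ : (⟨0, 21, 0, 112, 0⟩ : WeierstrassCurve ℚ).toAffine.Point) with hm
    have hm0 : m • (.some x₀ y₀ h₀ : (⟨0, 21, 0, 112, 0⟩ : WeierstrassCurve ℚ).toAffine.Point) = 0 :=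
      addOrderOf_nsmul_eq_zero _
    have hmz : (m : ℤ) • (.some x₀ y₀ h₀ : (⟨0, 21, 0, 112, 0⟩ : WeierstrassCurve ℚ).toAffine.Point) = 0 := by
      rw [natCast_zsmul]; exact hm0
    have hmz' := (point_zsmul_irrel (instDecidableEqRat)
      (fun a b => Classical.propDecidable (a = b)) (m : ℤ)
      (.some x₀ y₀ h₀ : (⟨0, 21, 0, 112, 0⟩ : WeierstrassCurve ℚ).toAffine.Point)).symm.trans hmz
    have hw : ratAdicValuation 2 (((m : ℕ) : ℤ) : ℚ) = 1 := by
      rw [ratAdicValuation_apply, ← NNReal.coe_eq_one, coe_nnnorm, Int.cast_natCast,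
        Rat.cast_natCast, Padic.norm_natCast_eq_one_iff]
      exact Nat.coprime_two_left.mpr hodd
    have := val_le_one_of_zsmul_eq_zero (V := (⟨0, 21, 0, 112, 0⟩ : WeierstrassCurve ℚ)) hw hmz'
    rw [ratAdicValuation_apply, ← NNReal.coe_le_coe, NNReal.coe_one, coe_nnnorm] at this
    exact this
  · have hp3 : 3 ≤ p := by
      have h2 := (Fact.out : p.Prime).two_le
      omega
    by_contra h1
    exact not_isOfFinAddOrder_of_one_lt_padicNorm_of_isIntegral
      (⟨0, 21, 0, 112, 0⟩ : WeierstrassCurve ℚ) p hp3 h₀ (not_le.mp h1) hfin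

/-- **In `V(ℚ)` the double of any point has odd order**: otherwise a suitable multiple
`R = j·(2Q)` would have order `2`, so `R = T` (`eq_T_of_add_self`), i.e. `T = 2(jQ)`,
contradicting `add_self_ne_T`. [folklore] -/
theorem odd_addOrderOf_add_self [Finite (⟨0, 21, 0, 112, 0⟩ : WeierstrassCurve ℚ).toAffine.Point]
    (Q : (⟨0, 21, 0, 112, 0⟩ : WeierstrassCurve ℚ).toAffine.Point) : Odd (addOrderOf (Q + Q)) := by
  by_contra heven
  rw [Nat.not_odd_iff_even] at heven
  obtain ⟨j, hj⟩ := heven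
  have hpos : 0 < addOrderOf (Q + Q) := (isOfFinAddOrder_of_finite _).addOrderOf_pos
  have hj0 : j ≠ 0 := by rintro rfl; omega
  have hR : addOrderOf (j • (Q + Q)) = 2 := by
    rw [addOrderOf_nsmul' (Q + Q) hj0, hj, ← two_mul, Nat.gcd_mul_left_left,
      Nat.mul_div_cancel _ (Nat.pos_of_ne_zero hj0)]
  have hR0 : j • (Q + Q) ≠ 0 := by
    intro h0
    rw [h0, addOrderOf_zero] at hR
    exact absurd hR (by norm_num)
  have hR2 : j • (Q + Q) + j • (Q + Q) = 0 := by
    rw [← two_nsmul, ← hR]; exact addOrderOf_nsmul_eq_zero _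
  have hT := eq_T_of_add_self hR2 hR0
  rw [nsmul_add] at hT
  exact add_self_ne_T (j • Q) hT

/-- **The rational points of `V`: `Y² = X³ + 21X² + 112X` has only the affine solution
`(0, 0)`**, i.e. `V(ℚ) = {O, T} ≅ ℤ/2` (Cremona's Table 1, `49a1`: `r = 0`, `|T| = 2`).
Proof: `V(ℚ)` is finite (`finite_point`: `2`-isogeny descent + Mordell–Weil); write a rational
point as `P = 2Q` or `2Q + T` (`exists_eq_add_self_or`); `P₀ = 2Q` has odd order, hence
integral abscissa `x₀` (`norm_le_one_of_odd`), and `x₀ = w²` by the duplication formula, so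
`w ∈ ℤ`, `v = y₀/w ∈ ℤ` with `v² = w⁴ + 21w² + 112`, impossible (`int_quartic_ne_sq`); thus
`P₀ = O` and `P ∈ {O, T}` has `X(P) = 0`. [cite: CremonaAlgorithms1997, Table 1 (49a1)] -/
theorem points_twoTorsionNF (x y : ℚ) (hxy : y ^ 2 = x ^ 3 + 21 * x ^ 2 + 112 * x) : x = 0 := by
  haveI := isElliptic
  haveI := finite_point
  have hfin : ∀ R : (⟨0, 21, 0, 112, 0⟩ : WeierstrassCurve ℚ).toAffine.Point, IsOfFinAddOrder R :=
    fun R => isOfFinAddOrder_of_finite R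
  have hns : (⟨0, 21, 0, 112, 0⟩ : WeierstrassCurve ℚ).toAffine.Nonsingular x y :=
    Affine.equation_iff_nonsingular.mp ((equation_iff x y).mpr hxy)
  obtain ⟨Q, hQ⟩ := exists_eq_add_self_or (.some x y hns)
  obtain ⟨P₀, hP₀⟩ : ∃ P₀ : (⟨0, 21, 0, 112, 0⟩ : WeierstrassCurve ℚ).toAffine.Point, P₀ = Q + Q :=
    ⟨_, rfl⟩
  rw [← hP₀] at hQ
  have hodd : Odd (addOrderOf P₀) := hP₀ ▸ odd_addOrderOf_add_self Q
  -- `P₀ = O`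
  have hcases : P₀ = 0 := by
    rcases hP : P₀ with _ | ⟨x₀, y₀, h₀⟩
    · rfl
    exfalso
    rw [hP] at hP₀ hodd
    -- `Q = (x₁, y₁)` with `y₁ ≠ 0`, and `x₀ = x(2Q)` is a square
    rcases Q with _ | ⟨x₁, y₁, h₁⟩
    · rw [← Affine.Point.zero_def, add_zero] at hP₀
      exact absurd hP₀ (Affine.Point.some_ne_zero _)
    by_cases hy₁ : y₁ = (⟨0, 21, 0, 112, 0⟩ : WeierstrassCurve ℚ).toAffine.negY x₁ y₁
    · rw [Affine.Point.add_self_of_Y_eq hy₁] at hP₀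
      exact absurd hP₀ (Affine.Point.some_ne_zero _)
    have key := addX_self_mul h₁ hy₁
    rw [Affine.Point.add_self_of_Y_ne hy₁, Affine.Point.some.injEq] at hP₀
    rw [← hP₀.1] at key
    have hy₁0 : y₁ ≠ 0 := by
      intro h0; apply hy₁; rw [negY_eq, h0, neg_zero]
    obtain ⟨w, hw⟩ : ∃ w : ℚ, w = (x₁ ^ 2 - 112) / (2 * y₁) := ⟨_, rfl⟩
    have hsq : x₀ = w ^ 2 := by
      rw [hw, div_pow, eq_div_iff (pow_ne_zero 2 (mul_ne_zero two_ne_zero hy₁0))]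
      linear_combination key
    -- integrality of `x₀`, `w` and `v = y₀ / w`
    have hden : x₀.den = 1 :=
      Rat.den_eq_one_of_forall_norm_le_one fun p _ => norm_le_one_of_odd (hfin _) hodd p
    have hx₀Z : ((x₀.num : ℤ) : ℚ) = x₀ := Rat.coe_int_num_of_den_eq_one hden
    have hwden : w.den = 1 := Rat.den_eq_one_of_sq_eq_intCast (n := x₀.num) (by rw [hx₀Z, hsq])
    have hwZ : ((w.num : ℤ) : ℚ) = w := Rat.coe_int_num_of_den_eq_one hwden
    have e₀ := rel h₀
    have hx₀0 : x₀ ≠ 0 := by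
      rintro rfl
      have hy₀ : y₀ = 0 := by simpa using e₀
      subst hy₀
      apply add_self_ne_T (.some x₁ y₁ h₁)
      rw [Affine.Point.add_self_of_Y_ne hy₁]
      exact (some_eq_some_of_eq _ hP₀.1 hP₀.2).choose_spec ▸ rfl
    have hw0 : w ≠ 0 := by rintro rfl; exact hx₀0 (by rw [hsq]; ring)
    have hv : (y₀ / w) ^ 2 = x₀ ^ 2 + 21 * x₀ + 112 := by
      rw [div_pow, div_eq_iff (pow_ne_zero 2 hw0)]
      linear_combination e₀ + (x₀ ^ 2 + 21 * x₀ + 112) * hsq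
    have hvden : (y₀ / w).den = 1 :=
      Rat.den_eq_one_of_sq_eq_intCast (n := x₀.num ^ 2 + 21 * x₀.num + 112) (by
        rw [hv]; push_cast; rw [hx₀Z])
    have hvZ : (((y₀ / w).num : ℤ) : ℚ) = y₀ / w := Rat.coe_int_num_of_den_eq_one hvden
    -- the integer equation `v² = k⁴ + 21k² + 112`, `x₀ = k²`
    have hk : x₀ = ((w.num : ℤ) : ℚ) ^ 2 := by rw [hwZ, hsq]
    have hZ : ((y₀ / w).num : ℤ) ^ 2 = (w.num ^ 2) ^ 2 + 21 * w.num ^ 2 + 112 := by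
      have : ((((y₀ / w).num : ℤ) : ℚ)) ^ 2 = (((w.num : ℤ) : ℚ) ^ 2) ^ 2 +
          21 * ((w.num : ℤ) : ℚ) ^ 2 + 112 := by rw [hvZ, hv, hk]
      exact_mod_cast this
    exact int_quartic_ne_sq hZ
  -- conclusion
  rcases hQ with hPQ | hPQ
  · rw [hcases] at hPQ
    exact absurd hPQ (Affine.Point.some_ne_zero _)
  · rw [hcases, zero_add, Affine.Point.some.injEq] at hPQ
    exact hPQ.1

/-- **The rational points of `X₀(49) = 49a1`: the only rational solution of
`y² + xy = x³ - x² - 2x - 1` is `(x, y) = (2, -1)`**, i.e. `49a1(ℚ) = {O, (2, -1)} ≅ ℤ/2`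
(Cremona's Table 1, `N = 49`, `49a1 = [1, -1, 0, -2, -1]`: `r = 0`, `|T| = 2`). The substitution
`X = 4x - 8`, `Y = 8y + 4x` maps a solution to a rational point of
`V : Y² = X³ + 21X² + 112X`, whose affine points have `X = 0` (`points_twoTorsionNF`); so
`x = 2`, and then `y² + 2y + 1 = 0`, `y = -1`. [cite: CremonaAlgorithms1997, Table 1 (49a1)] -/
theorem points (x y : ℚ) (hxy : y ^ 2 + x * y = x ^ 3 - x ^ 2 - 2 * x - 1) : x = 2 ∧ y = -1 := by
  have hV : (8 * y + 4 * x) ^ 2 = (4 * x - 8) ^ 3 + 21 * (4 * x - 8) ^ 2 + 112 * (4 * x - 8) := by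
    linear_combination 64 * hxy
  have hX := points_twoTorsionNF (4 * x - 8) (8 * y + 4 * x) hV
  have hx : x = 2 := by linarith
  subst hx
  refine ⟨rfl, ?_⟩
  have hy : (y + 1) ^ 2 = 0 := by linear_combination hxy
  have := pow_eq_zero_iff two_ne_zero |>.mp hy
  linarith

end Curve49A1

end Literature.NumberTheory.EllipticCurves

end
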